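import Summits.Ventures.Crystal3D.Theorems.StickyWulffConstantCoaxialWallLawOneFccQuadraticCount
import Summits.Ventures.Crystal3D.Theorems.StickyWulffConstantCoaxialWallLawBlockedWindow
import Summits.Ventures.Crystal3D.Theorems.StickyWulffConstantTextureLiminfTexShadowLineCountUniform
import Summits.Ventures.Crystal3D.Theorems.StickyWulffConstantGenericWallFloorAffineSampleDeficit
import Summits.Ventures.Crystal3D.Theorems.StickyWulffConstantGenericWallFloorSealing
import Literature.Algebra.EuclideanLattices.FccBccLattices
import HarnessLib

/-!
# Lattice lines of ONE layer crossing a cell height inside a lateral radius: tops from below, first entries from above (F_layer OneFcc, flux (b))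

HONEST FRAMING. Venture `Summits/Ventures/Crystal3D` (cell `crystal3d-full`); helper `--supports` the crux `CoaxialWallLaw`
(stmt-Ventures-19481, REGISTERED line `WallLedgerF`) in its role as owner of lane T's debt T-F2 / F_layer, OneFcc half; memo
HOME/wall-19481-p1/g16/TWO-FAMILY-LEDGER-g16.md §Ledger.  Elementary lattice geometry, standard axioms; nothing about the crux is claimed;
F-C1 not moved.

THE SETTING (one layer of a moved close-packed plate, abstractly).  A frame `L` and origin `s`; a model base point `base` and two HORIZONTAL
model vectors `r`, `r'` (`r₂ = r'₂ = 0`, `‖r‖ = 1`) with `det(r, r')² = 3/4` (a unimodular basis of the unit triangular layer lattice: `r` an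
in-plane root, `r'` its partner); the layer is `{L (base + i·r + j·r') + s}`, its LINES are `j = const`.  Heights in the cell are `x₂`; along a
line they step by `a = (L r)₂`, assumed `> 0` (a RISING root).  Pulled back, the cell vertical is `ν = L⁻¹ e₃`, `S² = 1 − ν₂²`, and the layer's
plane has model height `c = (base + L⁻¹ s)₂`; its horizontal trace at cell height `z` lies at distance `|c − z ν₂| / S` from the cell axis.  The
crossing points of consecutive lines with the height `z` form an arithmetic progression `Y₀ + j W` with `a·W = det·(−ν₁, ν₀, 0)`, so
`lateral² ≤ R²` is a quadratic condition in `j` whose root interval has length (…OneFccQuadraticCount)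
  `Λ(z, R) := 4 a √((R² S² − (c − z ν₂)²)₊) / (√3 · S²)`   (`= chord · a / ((√3/2) S)`, the per-root line count of the plane).
* `ap_disc_identity` — the coordinate identity behind the discriminant; `layer_height` — heights are affine along the layer;
* `trace_ap` — the crossing-point progression of the layer at height `z`: real parameters `t j` of the crossings, lateral² `= A j² + 2B j + C₀`,
  `A > 0`, and `2√((B² − A(C₀ − R²))₊)/A = Λ(z, R)` for every `R`;
* **`layer_tops_ge`** — if a finite `P` contains every layer site of height in `(z₀ − 1, z₀]` within lateral radius `R + 1`, then the sites of
  the layer in `P` that are TOPS for `z₀` (`p₂ ≤ z₀ < (p + L r)₂`) number `≥ Λ(z₀, R) − 1` (one per line whose crossing point is within `R`);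
* **`layer_firstAbove_le`** — any finite set of layer sites `b` with `z₁ ≤ b₂`, `(b − L r)₂ < z₁` (FIRST site of its line at height `≥ z₁`) and
  lateral radius `≤ R` numbers `≤ Λ(z₁, R + 1) + 1`.
WHAT THIS IS NOT: not the sum over layers / roots, not the charge comparison; F-C1 not moved.
-/

noncomputable section

namespace Summit.Ventures.Crystal3D.Theorems

open Summit.Ventures.Crystal3D Finset
open Literature.Algebra.EuclideanLattices (inner_fin_three norm_sq_fin_three)
open scoped InnerProductSpace

/-- The discriminant identity of the trace: `S²(‖Y‖² − z²) − (Y₁ν₀ − Y₀ν₁)² = (c − z ν₂)²` for `z = ⟪Y, ν⟫`, `‖ν‖ = 1`, `c = Y₂`. -/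
theorem ap_disc_identity (p q c ν0 ν1 ν2 z : ℝ) (hν : ν0 ^ 2 + ν1 ^ 2 + ν2 ^ 2 = 1) (hz : z = p * ν0 + q * ν1 + c * ν2) :
    (ν0 ^ 2 + ν1 ^ 2) * (p ^ 2 + q ^ 2 + c ^ 2 - z ^ 2) - (q * ν0 - p * ν1) ^ 2 = (c - z * ν2) ^ 2 := by
  linear_combination (c ^ 2 - z ^ 2) * hν + (-z - p * ν0 - q * ν1 + c * ν2) * hz

/-- The cell height of a moved model point: `(L y)₂ = ⟪y, L⁻¹ e₃⟫`. -/
theorem apply_two_eq_inner_symm (L : EuclideanSpace ℝ (Fin 3) ≃ₗᵢ[ℝ] EuclideanSpace ℝ (Fin 3)) (y : EuclideanSpace ℝ (Fin 3)) :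
    (L y) 2 = ⟪y, L.symm (EuclideanSpace.single (2 : Fin 3) (1 : ℝ))⟫_ℝ := by
  rw [← inner_single_two_one, ← LinearIsometryEquiv.inner_map_map L y, LinearIsometryEquiv.apply_symm_apply]

/-- Heights are affine along the layer. -/
theorem layer_height (L : EuclideanSpace ℝ (Fin 3) ≃ₗᵢ[ℝ] EuclideanSpace ℝ (Fin 3)) (s base r r' : EuclideanSpace ℝ (Fin 3))
    (t j : ℝ) : (L (base + t • r + j • r') + s) 2 = (L base + s) 2 + t * (L r) 2 + j * (L r') 2 := by
  simp only [map_add, LinearIsometryEquiv.map_smul, PiLp.add_apply, PiLp.smul_apply, smul_eq_mul]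
  ring

section Layer

variable (L : EuclideanSpace ℝ (Fin 3) ≃ₗᵢ[ℝ] EuclideanSpace ℝ (Fin 3)) (s base r r' : EuclideanSpace ℝ (Fin 3))
  (hr2 : r 2 = 0) (hr'2 : r' 2 = 0) (hr1 : ‖r‖ = 1) (hdet : (r 0 * r' 1 - r 1 * r' 0) ^ 2 = 3 / 4) (ha : 0 < (L r) 2)

include hr2 hr'2 hdet ha

/-- **The crossing-point progression of the layer at cell height `z`.**  See the module docstring. -/
theorem trace_ap (z : ℝ) : ∃ (t : ℤ → ℝ) (Y : ℤ → EuclideanSpace ℝ (Fin 3)) (A B C₀ : ℝ), 0 < A ∧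
    (∀ j : ℤ, (L base + s) 2 + t j * (L r) 2 + (j : ℝ) * (L r') 2 = z) ∧
    (∀ j : ℤ, L (Y j) = L (base + t j • r + (j : ℝ) • r') + s) ∧
    (∀ j : ℤ, (L (Y j)) 0 ^ 2 + (L (Y j)) 1 ^ 2 = A * (j : ℝ) ^ 2 + 2 * B * (j : ℝ) + C₀) ∧
    (∀ R : ℝ, 2 * Real.sqrt (max 0 (B ^ 2 - A * (C₀ - R ^ 2))) / A =
      4 * (L r) 2 * Real.sqrt (max 0 (R ^ 2 * (1 - (L.symm (EuclideanSpace.single (2 : Fin 3) (1 : ℝ))) 2 ^ 2) -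
        ((base + L.symm s) 2 - z * (L.symm (EuclideanSpace.single (2 : Fin 3) (1 : ℝ))) 2) ^ 2)) /
        (Real.sqrt 3 * (1 - (L.symm (EuclideanSpace.single (2 : Fin 3) (1 : ℝ))) 2 ^ 2))) := by
  -- pulled-back data
  set e₃ : EuclideanSpace ℝ (Fin 3) := EuclideanSpace.single (2 : Fin 3) (1 : ℝ) with he₃
  set ν : EuclideanSpace ℝ (Fin 3) := L.symm e₃ with hν
  set s' : EuclideanSpace ℝ (Fin 3) := L.symm s with hs'
  have hνn : ‖ν‖ = 1 := by rw [hν, LinearIsometryEquiv.norm_map, he₃, PiLp.norm_single, norm_one]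
  have hν1 : ν 0 ^ 2 + ν 1 ^ 2 + ν 2 ^ 2 = 1 := by rw [← norm_sq_fin_three, hνn, one_pow]
  have hLs' : L s' = s := by rw [hs', LinearIsometryEquiv.apply_symm_apply]
  set a : ℝ := (L r) 2 with ha_def
  set b : ℝ := (L r') 2 with hb_def
  have ha' : a = r 0 * ν 0 + r 1 * ν 1 := by
    rw [ha_def, apply_two_eq_inner_symm, inner_fin_three, hr2, zero_mul, add_zero]
  have hb' : b = r' 0 * ν 0 + r' 1 * ν 1 := by
    rw [hb_def, apply_two_eq_inner_symm, inner_fin_three, hr'2, zero_mul, add_zero]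
  have ha0 : a ≠ 0 := ha.ne'
  set H₀ : ℝ := (L base + s) 2 with hH₀
  set S2 : ℝ := 1 - ν 2 ^ 2 with hS2
  have hS2' : S2 = ν 0 ^ 2 + ν 1 ^ 2 := by rw [hS2]; linarith
  have hS2pos : 0 < S2 := by
    rw [hS2']
    by_contra hle
    push Not at hle
    have h0 : ν 0 = 0 := by nlinarith [sq_nonneg (ν 0), sq_nonneg (ν 1)]
    have h1 : ν 1 = 0 := by nlinarith [sq_nonneg (ν 0), sq_nonneg (ν 1)]
    have : a = 0 := by rw [ha', h0, h1]; ring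
    exact ha0 this
  set det : ℝ := r 0 * r' 1 - r 1 * r' 0 with hdet_def
  have hd2 : det ^ 2 = 3 / 4 := by rw [hdet_def, hdet]
  -- the parameters and the crossing points
  obtain ⟨t, ht⟩ : ∃ t : ℤ → ℝ, ∀ j, t j = (z - H₀ - (j : ℝ) * b) / a := ⟨_, fun _ => rfl⟩
  obtain ⟨Y, hY⟩ : ∃ Y : ℤ → EuclideanSpace ℝ (Fin 3), ∀ j, Y j = base + s' + (t j) • r + (j : ℝ) • r' :=
    ⟨_, fun _ => rfl⟩
  set W : EuclideanSpace ℝ (Fin 3) := r' - (b / a) • r with hW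
  have htz : ∀ j : ℤ, H₀ + t j * a + (j : ℝ) * b = z := by
    intro j; rw [ht]; field_simp; ring
  have hYj : ∀ j : ℤ, Y j = Y 0 + (j : ℝ) • W := by
    intro j
    rw [hY, hY, hW, Int.cast_zero, zero_smul, add_zero]
    have e : t j = t 0 - (j : ℝ) * (b / a) := by rw [ht, ht, Int.cast_zero, zero_mul, sub_zero]; field_simp
    rw [e, sub_smul, smul_sub, smul_smul]
    abel
  have hLY : ∀ j : ℤ, L (Y j) = L (base + (t j) • r + (j : ℝ) • r') + s := by
    intro j; rw [hY]; simp only [map_add, LinearIsometryEquiv.map_smul, hLs']; abel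
  have hYheight : ∀ j : ℤ, (L (Y j)) 2 = z := by
    intro j; rw [hLY, layer_height, ← hH₀, ← ha_def, ← hb_def]; exact htz j
  have hYν : ∀ j : ℤ, ⟪Y j, ν⟫_ℝ = z := fun j => by rw [← apply_two_eq_inner_symm, hYheight]
  -- coordinates
  set p : ℝ := (Y 0) 0 with hp
  set q : ℝ := (Y 0) 1 with hq
  set c : ℝ := (Y 0) 2 with hc
  have hc' : c = (base + s') 2 := by
    rw [hc, hY]; simp only [PiLp.add_apply, PiLp.smul_apply, smul_eq_mul, hr2, hr'2, mul_zero, add_zero]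
  have hW0 : a * W 0 = -(ν 1) * det := by
    have : a * W 0 = a * r' 0 - b * r 0 := by
      simp only [hW, PiLp.sub_apply, PiLp.smul_apply, smul_eq_mul]; field_simp
    rw [this, ha', hb', hdet_def]; ring
  have hW1 : a * W 1 = ν 0 * det := by
    have : a * W 1 = a * r' 1 - b * r 1 := by
      simp only [hW, PiLp.sub_apply, PiLp.smul_apply, smul_eq_mul]; field_simp
    rw [this, ha', hb', hdet_def]; ring
  have hW2 : W 2 = 0 := by simp only [hW, PiLp.sub_apply, PiLp.smul_apply, smul_eq_mul, hr2, hr'2, mul_zero, sub_zero]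
  have hz : z = p * ν 0 + q * ν 1 + c * ν 2 := by rw [← hYν 0, inner_fin_three]
  -- the quadratic
  set A : ℝ := W 0 ^ 2 + W 1 ^ 2 with hA
  set B : ℝ := p * W 0 + q * W 1 with hB
  set C₀ : ℝ := p ^ 2 + q ^ 2 + c ^ 2 - z ^ 2 with hC₀
  have hA' : a ^ 2 * A = det ^ 2 * S2 := by
    have : a ^ 2 * A = (a * W 0) ^ 2 + (a * W 1) ^ 2 := by rw [hA]; ring
    rw [this, hW0, hW1, hS2']; ring
  have hApos : 0 < A := by
    have hd : 0 < det ^ 2 := by rw [hd2]; norm_num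
    have : 0 < a ^ 2 * A := by rw [hA']; exact mul_pos hd hS2pos
    exact pos_of_mul_pos_right this (sq_nonneg a)
  have hdisc : ∀ R : ℝ, a ^ 2 * (B ^ 2 - A * (C₀ - R ^ 2)) = det ^ 2 * (R ^ 2 * S2 - (c - z * ν 2) ^ 2) := by
    intro R
    have e1 : a ^ 2 * (B ^ 2 - A * (C₀ - R ^ 2)) = (a * B) ^ 2 - (a ^ 2 * A) * (C₀ - R ^ 2) := by ring
    have e2 : a * B = det * (q * ν 0 - p * ν 1) := by
      have : a * B = p * (a * W 0) + q * (a * W 1) := by rw [hB]; ring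
      rw [this, hW0, hW1]; ring
    rw [e1, e2, hA', hC₀, hS2']
    have key := ap_disc_identity p q c (ν 0) (ν 1) (ν 2) z hν1 hz
    linear_combination (-(det ^ 2)) * key
  refine ⟨t, Y, A, B, C₀, hApos, htz, hLY, ?_, ?_⟩
  · -- lateral² along the progression
    intro j
    rw [sq_add_sq_eq_norm_sq_sub, LinearIsometryEquiv.norm_map, inner_single_two_one, hYheight, hYj, norm_sq_fin_three]
    simp only [PiLp.add_apply, PiLp.smul_apply, smul_eq_mul, hW2, mul_zero, add_zero, hA, hB, hC₀, hp, hq, hc]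
    ring
  · -- the counting quantity
    intro R
    have hApos' : 0 < a := ha
    have hAeq : A = 3 / 4 / a ^ 2 * S2 := by
      rw [div_mul_eq_mul_div, eq_div_iff (by positivity)]
      linear_combination hA' + S2 * hd2
    have hdisc' : B ^ 2 - A * (C₀ - R ^ 2) = 3 / 4 / a ^ 2 * (R ^ 2 * S2 - (c - z * ν 2) ^ 2) := by
      rw [div_mul_eq_mul_div, eq_div_iff (by positivity)]
      linear_combination hdisc R + (R ^ 2 * S2 - (c - z * ν 2) ^ 2) * hd2
    have h34 : 0 ≤ 3 / 4 / a ^ 2 := by positivity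
    have hmax : max 0 (B ^ 2 - A * (C₀ - R ^ 2)) = 3 / 4 / a ^ 2 * max 0 (R ^ 2 * S2 - (c - z * ν 2) ^ 2) := by
      rw [hdisc', mul_max_of_nonneg _ _ h34, mul_zero]
    have h3 : Real.sqrt (3 / 4 / a ^ 2) = Real.sqrt 3 / 2 / a := by
      rw [Real.sqrt_div' _ (by positivity), Real.sqrt_sq hApos'.le, Real.sqrt_div' _ (by norm_num),
        show (4 : ℝ) = 2 ^ 2 by norm_num, Real.sqrt_sq (by norm_num)]
    rw [hmax, Real.sqrt_mul h34, h3, hAeq, hc']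
    have hs3 : 0 < Real.sqrt 3 := Real.sqrt_pos.2 (by norm_num)
    have hS2ne : S2 ≠ 0 := hS2pos.ne'
    have h33 : Real.sqrt 3 ^ 2 = 3 := Real.sq_sqrt (by norm_num)
    rw [hS2]  at hS2ne ⊢
    field_simp
    rw [h33]
    ring

include hr1

open scoped Classical in
/-- **TOPS FROM BELOW.**  See the module docstring. -/
theorem layer_tops_ge (z₀ R : ℝ) (hR : 0 ≤ R) (P : Finset (EuclideanSpace ℝ (Fin 3)))
    (hP : ∀ i j : ℤ, z₀ - 1 < (L (base + (i : ℝ) • r + (j : ℝ) • r') + s) 2 →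
      (L (base + (i : ℝ) • r + (j : ℝ) • r') + s) 2 ≤ z₀ →
      (L (base + (i : ℝ) • r + (j : ℝ) • r') + s) 0 ^ 2 + (L (base + (i : ℝ) • r + (j : ℝ) • r') + s) 1 ^ 2 ≤ (R + 1) ^ 2 →
      L (base + (i : ℝ) • r + (j : ℝ) • r') + s ∈ P) :
    4 * (L r) 2 * Real.sqrt (max 0 (R ^ 2 * (1 - (L.symm (EuclideanSpace.single (2 : Fin 3) (1 : ℝ))) 2 ^ 2) -
        ((base + L.symm s) 2 - z₀ * (L.symm (EuclideanSpace.single (2 : Fin 3) (1 : ℝ))) 2) ^ 2)) /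
        (Real.sqrt 3 * (1 - (L.symm (EuclideanSpace.single (2 : Fin 3) (1 : ℝ))) 2 ^ 2)) - 1 ≤
      ((P.filter fun p => (∃ i j : ℤ, p = L (base + (i : ℝ) • r + (j : ℝ) • r') + s) ∧
        p 2 ≤ z₀ ∧ z₀ < (p + L r) 2).card : ℝ) := by
  obtain ⟨t, Y, A, B, C₀, hApos, htz, hLY, hlat, hΛ⟩ := trace_ap L s base r r' hr2 hr'2 hdet ha z₀
  rw [← hΛ R]
  set a : ℝ := (L r) 2 with ha_def
  have ha1 : a ≤ 1 := by
    have h1 := abs_real_inner_le_norm r (L.symm (EuclideanSpace.single (2 : Fin 3) (1 : ℝ)))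
    rw [hr1, LinearIsometryEquiv.norm_map, PiLp.norm_single, norm_one, one_mul, ← apply_two_eq_inner_symm] at h1
    exact (abs_le.1 h1).2
  -- the top of each line
  obtain ⟨ι, hι⟩ : ∃ ι : ℤ → ℤ, ∀ j, ι j = ⌊t j⌋ := ⟨_, fun _ => rfl⟩
  obtain ⟨site, hsite⟩ : ∃ site : ℤ → EuclideanSpace ℝ (Fin 3), ∀ j, site j = L (base + ((ι j : ℤ) : ℝ) • r + (j : ℝ) • r') + s :=
    ⟨_, fun _ => rfl⟩
  have hsite2 : ∀ j : ℤ, (site j) 2 = (L base + s) 2 + (ι j : ℝ) * a + (j : ℝ) * (L r') 2 := fun j => by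
    rw [hsite, layer_height]
  have htop : ∀ j : ℤ, (site j) 2 ≤ z₀ ∧ z₀ < (site j) 2 + a ∧ z₀ - 1 < (site j) 2 := by
    intro j
    have h1 : (ι j : ℝ) ≤ t j := by rw [hι]; exact Int.floor_le _
    have h2 : t j < (ι j : ℝ) + 1 := by rw [hι]; exact Int.lt_floor_add_one _
    have e := htz j
    have m1 : (ι j : ℝ) * a ≤ t j * a := mul_le_mul_of_nonneg_right h1 ha.le
    have m2 : t j * a < ((ι j : ℝ) + 1) * a := mul_lt_mul_of_pos_right h2 ha
    rw [hsite2]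
    refine ⟨by linarith, by linarith, by nlinarith⟩
  have hdist : ∀ j : ℤ, dist (site j) (L (Y j)) < 1 := by
    intro j
    rw [hLY, hsite, dist_add_right, LinearIsometryEquiv.dist_map, dist_eq_norm]
    have : base + ((ι j : ℤ) : ℝ) • r + (j : ℝ) • r' - (base + t j • r + (j : ℝ) • r') = (((ι j : ℤ) : ℝ) - t j) • r := by
      rw [sub_smul]; abel
    rw [this, norm_smul, hr1, mul_one, Real.norm_eq_abs, abs_sub_comm, abs_lt, hι]
    constructor <;> linarith [Int.floor_le (t j), Int.lt_floor_add_one (t j)]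
  -- a good line has its top in the filtered set
  have hgood : ∀ j : ℤ, A * (j : ℝ) ^ 2 + 2 * B * (j : ℝ) + (C₀ - R ^ 2) ≤ 0 →
      site j ∈ P.filter fun p => (∃ i j : ℤ, p = L (base + (i : ℝ) • r + (j : ℝ) • r') + s) ∧ p 2 ≤ z₀ ∧ z₀ < (p + L r) 2 := by
    intro j hj
    obtain ⟨h1, h2, h3⟩ := htop j
    have h0Y : 0 ≤ (L (Y j)) 0 ^ 2 + (L (Y j)) 1 ^ 2 := by positivity
    have hlatY : Real.sqrt ((L (Y j)) 0 ^ 2 + (L (Y j)) 1 ^ 2) ≤ R := by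
      rw [← Real.sqrt_sq hR]; exact Real.sqrt_le_sqrt (by rw [hlat j]; linarith)
    have hlatS : (site j) 0 ^ 2 + (site j) 1 ^ 2 ≤ (R + 1) ^ 2 := by
      have h := lateral_radius_le_add_dist (site j) (L (Y j))
      have h' : Real.sqrt ((site j) 0 ^ 2 + (site j) 1 ^ 2) ≤ R + 1 := by linarith [hdist j]
      have h0 : 0 ≤ (site j) 0 ^ 2 + (site j) 1 ^ 2 := by positivity
      nlinarith [Real.sq_sqrt h0, Real.sqrt_nonneg ((site j) 0 ^ 2 + (site j) 1 ^ 2)]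
    have hmem : site j ∈ P := by rw [hsite] at h3 h1 hlatS ⊢; exact hP (ι j) j h3 h1 hlatS
    refine mem_filter.2 ⟨hmem, ⟨ι j, j, hsite j⟩, h1, ?_⟩
    rw [PiLp.add_apply]; exact h2
  -- a finite set of good lines containing all good lines
  obtain ⟨T, hTsol, hTall⟩ : ∃ T : Finset ℤ, (∀ j ∈ T, A * (j : ℝ) ^ 2 + 2 * B * (j : ℝ) + (C₀ - R ^ 2) ≤ 0) ∧
      (∀ j : ℤ, A * (j : ℝ) ^ 2 + 2 * B * (j : ℝ) + (C₀ - R ^ 2) ≤ 0 → j ∈ T) := by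
    by_cases hD : 0 ≤ B ^ 2 - A * (C₀ - R ^ 2)
    · refine ⟨(Finset.Icc ⌈(-B - Real.sqrt (B ^ 2 - A * (C₀ - R ^ 2))) / A⌉
          ⌊(-B + Real.sqrt (B ^ 2 - A * (C₀ - R ^ 2))) / A⌋).filter
          fun j => A * (j : ℝ) ^ 2 + 2 * B * (j : ℝ) + (C₀ - R ^ 2) ≤ 0, fun j hj => (mem_filter.1 hj).2, fun j hj => ?_⟩
      obtain ⟨h1, h2⟩ := (quadratic_nonpos_iff hApos hD (j : ℝ)).1 hj
      exact mem_filter.2 ⟨Finset.mem_Icc.2 ⟨Int.ceil_le.2 h1, Int.le_floor.2 h2⟩, hj⟩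
    · push Not at hD
      exact ⟨∅, fun j hj => absurd hj (Finset.notMem_empty j), fun j hj =>
        absurd hj (not_le.2 (quadratic_pos_of_disc_neg hApos hD (j : ℝ)))⟩
  have hcount := card_int_quadratic_ge hApos T hTall
  -- inject the good lines into the filtered sites
  have hdet0 : r 0 * r' 1 - r 1 * r' 0 ≠ 0 := by
    intro h; rw [h] at hdet; norm_num at hdet
  have hinj : T.card ≤ (P.filter fun p => (∃ i j : ℤ, p = L (base + (i : ℝ) • r + (j : ℝ) • r') + s) ∧
      p 2 ≤ z₀ ∧ z₀ < (p + L r) 2).card := by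
    refine card_le_card_of_injOn site (fun j hj => hgood j (hTsol j hj)) ?_
    intro j₁ _ j₂ _ h12
    have e : base + ((ι j₁ : ℤ) : ℝ) • r + (j₁ : ℝ) • r' = base + ((ι j₂ : ℤ) : ℝ) • r + (j₂ : ℝ) • r' := by
      have h' := h12
      rw [hsite, hsite] at h'
      exact L.injective (add_right_cancel h')
    have e0 := congrArg (fun v : EuclideanSpace ℝ (Fin 3) => v 0) e
    have e1 := congrArg (fun v : EuclideanSpace ℝ (Fin 3) => v 1) e
    simp only [PiLp.add_apply, PiLp.smul_apply, smul_eq_mul] at e0 e1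
    have hcross : ((j₁ : ℝ) - (j₂ : ℝ)) * (r 0 * r' 1 - r 1 * r' 0) = 0 := by
      linear_combination (-(r 1)) * e0 + (r 0) * e1
    have hj : (j₁ : ℝ) - (j₂ : ℝ) = 0 := by
      rcases mul_eq_zero.1 hcross with h | h
      · exact h
      · exact absurd h hdet0
    exact_mod_cast sub_eq_zero.1 hj
  have : (T.card : ℝ) ≤ ((P.filter fun p => (∃ i j : ℤ, p = L (base + (i : ℝ) • r + (j : ℝ) • r') + s) ∧
      p 2 ≤ z₀ ∧ z₀ < (p + L r) 2).card : ℝ) := by exact_mod_cast hinj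
  linarith

open scoped Classical in
/-- **FIRST ENTRIES FROM ABOVE.**  See the module docstring. -/
theorem layer_firstAbove_le (z₁ R : ℝ) (hR : 0 ≤ R) (Q : Finset (EuclideanSpace ℝ (Fin 3)))
    (hQ : ∀ b ∈ Q, (∃ i j : ℤ, b = L (base + (i : ℝ) • r + (j : ℝ) • r') + s) ∧ z₁ ≤ b 2 ∧ (b - L r) 2 < z₁ ∧
      b 0 ^ 2 + b 1 ^ 2 ≤ R ^ 2) :
    (Q.card : ℝ) ≤
      4 * (L r) 2 * Real.sqrt (max 0 ((R + 1) ^ 2 * (1 - (L.symm (EuclideanSpace.single (2 : Fin 3) (1 : ℝ))) 2 ^ 2) -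
        ((base + L.symm s) 2 - z₁ * (L.symm (EuclideanSpace.single (2 : Fin 3) (1 : ℝ))) 2) ^ 2)) /
        (Real.sqrt 3 * (1 - (L.symm (EuclideanSpace.single (2 : Fin 3) (1 : ℝ))) 2 ^ 2)) + 1 := by
  obtain ⟨t, Y, A, B, C₀, hApos, htz, hLY, hlat, hΛ⟩ := trace_ap L s base r r' hr2 hr'2 hdet ha z₁
  rw [← hΛ (R + 1)]
  set a : ℝ := (L r) 2 with ha_def
  -- the line index of a member of `Q`
  have hcoord : ∀ b ∈ Q, ∃ ij : ℤ × ℤ, b = L (base + ((ij.1 : ℤ) : ℝ) • r + ((ij.2 : ℤ) : ℝ) • r') + s := by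
    intro b hb
    obtain ⟨⟨i, j, rfl⟩, -⟩ := hQ b hb
    exact ⟨(i, j), rfl⟩
  choose! ij hij using hcoord
  have hb2 : ∀ b ∈ Q, b 2 = (L base + s) 2 + ((ij b).1 : ℝ) * a + ((ij b).2 : ℝ) * (L r') 2 := by
    intro b hb
    conv_lhs => rw [hij b hb]
    rw [layer_height]
  -- each member's line is good at radius `R + 1`
  have hline : ∀ b ∈ Q, A * ((ij b).2 : ℝ) ^ 2 + 2 * B * ((ij b).2 : ℝ) + (C₀ - (R + 1) ^ 2) ≤ 0 := by
    intro b hb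
    obtain ⟨-, h1, h2, h3⟩ := hQ b hb
    rw [PiLp.sub_apply, hb2 b hb] at h2
    rw [hb2 b hb] at h1
    have e := htz (ij b).2
    have hti : |((ij b).1 : ℝ) - t (ij b).2| < 1 := by
      rw [abs_lt]; constructor <;> nlinarith
    have hd : dist b (L (Y (ij b).2)) < 1 := by
      have key : ∀ i j : ℤ, dist (L (base + (i : ℝ) • r + (j : ℝ) • r') + s) (L (Y j)) = |(i : ℝ) - t j| := by
        intro i j
        rw [hLY, dist_add_right, LinearIsometryEquiv.dist_map, dist_eq_norm]
        have : base + (i : ℝ) • r + (j : ℝ) • r' - (base + t j • r + (j : ℝ) • r') = ((i : ℝ) - t j) • r := by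
          rw [sub_smul]; abel
        rw [this, norm_smul, hr1, mul_one, Real.norm_eq_abs]
      have := key (ij b).1 (ij b).2
      rw [← hij b hb] at this
      rw [this]; exact hti
    have hlatY : Real.sqrt ((L (Y (ij b).2)) 0 ^ 2 + (L (Y (ij b).2)) 1 ^ 2) ≤ R + 1 := by
      have h := lateral_radius_le_add_dist (L (Y (ij b).2)) b
      have hb' : Real.sqrt (b 0 ^ 2 + b 1 ^ 2) ≤ R := by
        rw [← Real.sqrt_sq hR]; exact Real.sqrt_le_sqrt h3
      rw [dist_comm] at hd
      linarith
    have h0 : 0 ≤ (L (Y (ij b).2)) 0 ^ 2 + (L (Y (ij b).2)) 1 ^ 2 := by positivity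
    have hsq : (L (Y (ij b).2)) 0 ^ 2 + (L (Y (ij b).2)) 1 ^ 2 ≤ (R + 1) ^ 2 := by
      nlinarith [Real.sq_sqrt h0, Real.sqrt_nonneg ((L (Y (ij b).2)) 0 ^ 2 + (L (Y (ij b).2)) 1 ^ 2)]
    rw [hlat] at hsq
    linarith
  -- `b ↦ j(b)` is injective on `Q`: the first site above `z₁` on a line is unique
  have hinj : Set.InjOn (fun b => (ij b).2) ↑Q := by
    intro b₁ hb₁ b₂ hb₂ hjj
    have hb₁' := mem_coe.1 hb₁
    have hb₂' := mem_coe.1 hb₂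
    obtain ⟨-, h1, h2, -⟩ := hQ b₁ hb₁'
    obtain ⟨-, h1', h2', -⟩ := hQ b₂ hb₂'
    rw [PiLp.sub_apply, hb2 b₁ hb₁'] at h2
    rw [PiLp.sub_apply, hb2 b₂ hb₂'] at h2'
    rw [hb2 b₁ hb₁'] at h1
    rw [hb2 b₂ hb₂'] at h1'
    simp only at hjj
    have hjj' : ((ij b₁).2 : ℝ) = ((ij b₂).2 : ℝ) := by exact_mod_cast hjj
    rw [hjj'] at h1 h2
    have ha0 : 0 < a := ha
    have h3 : (((ij b₁).1 : ℝ) - ((ij b₂).1 : ℝ)) * a < a := by nlinarith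
    have h4 : (((ij b₂).1 : ℝ) - ((ij b₁).1 : ℝ)) * a < a := by nlinarith
    have h5 : ((ij b₁).1 : ℝ) - ((ij b₂).1 : ℝ) < 1 := by
      by_contra hh; push Not at hh; nlinarith
    have h6 : ((ij b₂).1 : ℝ) - ((ij b₁).1 : ℝ) < 1 := by
      by_contra hh; push Not at hh; nlinarith
    have h7 : (ij b₁).1 - (ij b₂).1 < 1 := by exact_mod_cast h5
    have h8 : (ij b₂).1 - (ij b₁).1 < 1 := by exact_mod_cast h6
    have hi : (ij b₁).1 = (ij b₂).1 := by omega
    rw [hij b₁ hb₁', hij b₂ hb₂', hi, hjj]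
  -- count
  set T : Finset ℤ := Q.image fun b => (ij b).2 with hT
  have hTcard : T.card = Q.card := card_image_of_injOn hinj
  have hTsol : ∀ j ∈ T, A * (j : ℝ) ^ 2 + 2 * B * (j : ℝ) + (C₀ - (R + 1) ^ 2) ≤ 0 := by
    intro j hj
    obtain ⟨b, hb, rfl⟩ := mem_image.1 hj
    exact hline b hb
  have hcount := card_int_quadratic_le hApos T hTsol
  rw [hTcard] at hcount
  exact hcount

end Layer

end Summit.Ventures.Crystal3D.Theorems

end
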